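import Summits.CriticalPhenomena.PercolationContinuityZ3.Theorems.SahiBoxTP2Kernel
import Summits.CriticalPhenomena.PercolationContinuityZ3.Theorems.SahiLiebSahiContinuumKernel

/-!
# Box-TP₂ laws on the unit cube: heredity under splitting off the last coordinate, and the ball cut condition

Support file of the Sahi cell (`prim-sahi`, typer seat, generation 11; `--supports stmt-CriticalPhenomena-4575`).
First half of the coupling theorem of `SahiBoxTP2Coupling.lean`.

`IsBoxTP2 μ` — **total positivity of order two on closed boxes** — asks
`μ[a,b] · μ[a',b'] ≤ μ[a ⊓ a', b ⊓ b'] · μ[a ⊔ a', b ⊔ b']` for all closed order intervals of a measurable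
lattice.  On `Q_d = (Fin d → [0,1])` it is the FKG lattice condition restricted to boxes: an INTRINSIC notion for
arbitrary (singular) probability measures, satisfied by every product measure (`SahiBoxTP2Positivity.lean`) and by
every MTP₂ density.  This file proves, for a box-TP₂ law `μ` on `Q_{d+1}` and the split
`x ↦ ((x_0,…,x_{d-1}), x_d)` (`initLast`, Mathlib's `piFinSuccAbove` at the last index, an order isomorphism):

* `IsBoxTP2.fst_initLast` — the law of the first `d` coordinates is box-TP₂;
* `IsBoxTP2.isBallTP2Cut_lawInitLastReal` — the pair (first `d` coordinates, last coordinate read in `ℝ`)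
  satisfies `SahiBoxTP2Kernel.IsBallTP2Cut`: two sup-metric balls of equal radius around `x ≤ x'` in `Q_d` are
  closed boxes in the strong set order (`closedBall_eq_Icc`, clamped corners `loCorner`/`hiCorner`), the closed
  sides give the inequality by `IsBoxTP2` (`IsBoxTP2.prod_closed_sides`), and the open side `(t,1]` is the
  increasing union of closed sides (`iUnion_Icc_eq_Ioi`);
* `instHasBesicovitchCoveringCube` — `Q_d` has the Besicovitch covering property (it is isometric to a subset of
  `ℝ^d` with the sup norm; `hasBesicovitchCovering_of_isometry`), so `SahiBoxTP2Kernel.exists_aeCisKernel` applies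
  with conditioning space `Q_d`.

No sorries, no new axioms.
-/

noncomputable section

namespace Summit.CriticalPhenomena.PercolationContinuityZ3.Theorems.SahiBoxTP2

open MeasureTheory ProbabilityTheory Set Filter Topology Metric Function
open scoped ENNReal unitInterval

/-! ### TP₂ on closed boxes -/

/-- **Total positivity of order two on closed boxes** (the FKG lattice condition for closed order intervals of a
measurable lattice): `μ[a,b] · μ[a',b'] ≤ μ[a ⊓ a', b ⊓ b'] · μ[a ⊔ a', b ⊔ b']`.  On a product of chains the two
intervals on the right are the pointwise meets and joins of the two on the left.  Intrinsic for arbitrary (singular)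
measures; on `Q_d` satisfied by product measures and MTP₂ densities. [this work] -/
def IsBoxTP2 {β : Type*} [Lattice β] [MeasurableSpace β] (μ : Measure β) : Prop :=
  ∀ a b a' b' : β, μ (Icc a b) * μ (Icc a' b') ≤ μ (Icc (a ⊓ a') (b ⊓ b')) * μ (Icc (a ⊔ a') (b ⊔ b'))

/-! ### The Besicovitch covering property of the unit cube -/

/-- **The Besicovitch covering property passes to isometrically embedded spaces** (a satellite configuration of the
small space is one of the large space). [folklore] -/
theorem hasBesicovitchCovering_of_isometry {α β : Type*} [MetricSpace α] [MetricSpace β]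
    [HasBesicovitchCovering α] {f : β → α} (hf : Isometry f) : HasBesicovitchCovering β := by
  obtain ⟨N, τ, hτ, hN⟩ := HasBesicovitchCovering.no_satelliteConfig (α := α)
  refine ⟨N, τ, hτ, ⟨fun c => hN.false ?_⟩⟩
  exact
    { c := f ∘ c.c
      r := c.r
      rpos := c.rpos
      h := fun i j hij => by simpa only [Function.comp_apply, hf.dist_eq] using c.h hij
      hlast := fun i hi => by simpa only [Function.comp_apply, hf.dist_eq] using c.hlast i hi
      inter := fun i hi => by simpa only [Function.comp_apply, hf.dist_eq] using c.inter i hi }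

/-- The coordinatewise inclusion `Q_d → ℝ^d` is an isometry (sup metrics). [folklore] -/
theorem isometry_coeCube (d : ℕ) : Isometry (fun (x : Fin d → I) (i : Fin d) => (x i : ℝ)) :=
  fun x y => by simp only [edist_pi_def]; rfl

/-- **The unit cube `Q_d` (sup metric) has the Besicovitch covering property.** [folklore] -/
instance instHasBesicovitchCoveringCube (d : ℕ) : HasBesicovitchCovering (Fin d → I) :=
  hasBesicovitchCovering_of_isometry (isometry_coeCube d)

/-! ### Sup-metric balls of the cube are boxes -/

section Balls

variable {d : ℕ}

/-- Lower corner of the closed sup-ball `B̄(x,h)` of `Q_d`: `max(x_i − h, 0)`. [folklore] -/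
def loCorner (x : Fin d → I) (h : ℝ) : Fin d → I := fun i => projIcc 0 1 zero_le_one ((x i : ℝ) - h)

/-- Upper corner of the closed sup-ball `B̄(x,h)` of `Q_d`: `min(x_i + h, 1)`. [folklore] -/
def hiCorner (x : Fin d → I) (h : ℝ) : Fin d → I := fun i => projIcc 0 1 zero_le_one ((x i : ℝ) + h)

/-- The corners are monotone in the centre. [folklore] -/
theorem loCorner_mono {x x' : Fin d → I} (hxx' : x ≤ x') (h : ℝ) : loCorner x h ≤ loCorner x' h :=
  fun i => monotone_projIcc _ (sub_le_sub_right (Subtype.coe_le_coe.2 (hxx' i)) h)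

/-- The corners are monotone in the centre. [folklore] -/
theorem hiCorner_mono {x x' : Fin d → I} (hxx' : x ≤ x') (h : ℝ) : hiCorner x h ≤ hiCorner x' h :=
  fun i => monotone_projIcc _ (by have := Subtype.coe_le_coe.2 (hxx' i); linarith)

/-- **A closed sup-ball of `Q_d` is the closed box between its clamped corners.** [folklore] -/
theorem closedBall_eq_Icc (x : Fin d → I) {h : ℝ} (hh : 0 ≤ h) :
    closedBall x h = Icc (loCorner x h) (hiCorner x h) := by
  rw [closedBall_pi _ hh, ← Set.pi_univ_Icc]
  refine Set.pi_congr rfl fun i _ => ?_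
  ext y
  simp only [mem_closedBall, mem_Icc, loCorner, hiCorner]
  rw [Subtype.dist_eq, Real.dist_eq, abs_sub_le_iff, ← Subtype.coe_le_coe, ← Subtype.coe_le_coe, coe_projIcc,
    coe_projIcc]
  have hx0 := (x i).2.1; have hx1 := (x i).2.2; have hy0 := y.2.1; have hy1 := y.2.2
  constructor
  · rintro ⟨h1, h2⟩
    exact ⟨max_le hy0 (min_le_of_right_le (by linarith)), le_max_of_le_right (le_min hy1 (by linarith))⟩
  · rintro ⟨h1, h2⟩
    have hlo : (x i : ℝ) - h ≤ y := by
      have e1 : min (1 : ℝ) ((x i : ℝ) - h) = (x i : ℝ) - h := min_eq_right (by linarith)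
      exact (e1.symm.le.trans (le_max_right _ _)).trans h1
    have hhi : (y : ℝ) ≤ (x i : ℝ) + h := by
      have e2 : max (0 : ℝ) (min 1 ((x i : ℝ) + h)) = min 1 ((x i : ℝ) + h) :=
        max_eq_right (le_min zero_le_one (by linarith))
      exact (h2.trans e2.le).trans (min_le_right _ _)
    constructor <;> linarith

end Balls

/-! ### Splitting off the last coordinate: `Q_{d+1} ≃ [0,1] × Q_d` -/

section Split

variable {d : ℕ}

/-- The measurable order isomorphism `x ↦ (x_d, (x_0,…,x_{d-1}))` (Mathlib's `piFinSuccAbove` at the last index). -/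
abbrev splitLast (d : ℕ) : (Fin (d + 1) → I) ≃ᵐ I × (Fin d → I) :=
  MeasurableEquiv.piFinSuccAbove (fun _ : Fin (d + 1) => I) (Fin.last d)

/-- `x ↦ ((x_0,…,x_{d-1}), x_d)`: first `d` coordinates, then the last one. -/
def initLast (x : Fin (d + 1) → I) : (Fin d → I) × I := ((splitLast d x).2, (splitLast d x).1)

/-- `initLast` is measurable. [folklore] -/
theorem measurable_initLast : Measurable (initLast (d := d)) :=
  (measurable_snd.comp (splitLast d).measurable).prodMk (measurable_fst.comp (splitLast d).measurable)

/-- `splitLast` is the inverse of the order isomorphism `Fin.insertNthOrderIso` (definitionally). [folklore] -/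
theorem splitLast_apply (x : Fin (d + 1) → I) :
    splitLast d x = (Fin.insertNthOrderIso (fun _ => I) (Fin.last d)).symm x := rfl

/-- `splitLast.symm` is the order isomorphism `Fin.insertNthOrderIso` (definitionally). [folklore] -/
theorem splitLast_symm_apply (p : I × (Fin d → I)) :
    (splitLast d).symm p = Fin.insertNthOrderIso (fun _ => I) (Fin.last d) p := rfl

/-- `splitLast` is monotone. [folklore] -/
theorem splitLast_mono : Monotone (splitLast d) := fun x y hxy => by
  rw [splitLast_apply, splitLast_apply]; exact (OrderIso.monotone _ hxy)

/-- `splitLast.symm` is monotone. [folklore] -/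
theorem splitLast_symm_mono : Monotone (splitLast d).symm := fun x y hxy => by
  rw [splitLast_symm_apply, splitLast_symm_apply]; exact (OrderIso.monotone _ hxy)

/-- Preimage of a product of closed boxes under `initLast` is a closed box of `Q_{d+1}`. [folklore] -/
theorem initLast_preimage_Icc_prod_Icc (a b : Fin d → I) (s t : I) :
    initLast ⁻¹' (Icc a b ×ˢ Icc s t) = Icc ((splitLast d).symm (s, a)) ((splitLast d).symm (t, b)) := by
  ext x
  change (Fin.removeNth (Fin.last d) x ∈ Icc a b ∧ x (Fin.last d) ∈ Icc s t) ↔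
    x ∈ Icc (Fin.insertNth (Fin.last d) s a) (Fin.insertNth (Fin.last d) t b)
  simp only [mem_Icc, Fin.le_insertNth_iff, Fin.insertNth_le_iff]
  tauto

/-- Meets of the reassembled corners (the split is a lattice isomorphism). [folklore] -/
theorem splitLast_symm_inf (s s' : I) (a a' : Fin d → I) :
    (splitLast d).symm (s, a) ⊓ (splitLast d).symm (s', a') = (splitLast d).symm (s ⊓ s', a ⊓ a') := by
  rw [splitLast_symm_apply, splitLast_symm_apply, splitLast_symm_apply, ← OrderIso.map_inf]; rfl

/-- Joins of the reassembled corners (the split is a lattice isomorphism). [folklore] -/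
theorem splitLast_symm_sup (s s' : I) (a a' : Fin d → I) :
    (splitLast d).symm (s, a) ⊔ (splitLast d).symm (s', a') = (splitLast d).symm (s ⊔ s', a ⊔ a') := by
  rw [splitLast_symm_apply, splitLast_symm_apply, splitLast_symm_apply, ← OrderIso.map_sup]; rfl

variable (μ : Measure (Fin (d + 1) → I))

/-- The law of `((x_0,…,x_{d-1}), x_d)` gives product boxes the mass of the reassembled box. [folklore] -/
theorem map_initLast_Icc_prod_Icc (a b : Fin d → I) (s t : I) :
    μ.map initLast (Icc a b ×ˢ Icc s t) = μ (Icc ((splitLast d).symm (s, a)) ((splitLast d).symm (t, b))) := by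
  rw [Measure.map_apply measurable_initLast (measurableSet_Icc.prod measurableSet_Icc),
    initLast_preimage_Icc_prod_Icc]

/-- **Box-TP₂ passes to the first `d` coordinates.** [this work] -/
theorem IsBoxTP2.fst_initLast {μ : Measure (Fin (d + 1) → I)} (hμ : IsBoxTP2 μ) :
    IsBoxTP2 (μ.map initLast).fst := by
  intro a b a' b'
  have h : ∀ a b : Fin d → I, (μ.map initLast).fst (Icc a b) =
      μ (Icc ((splitLast d).symm (⊥, a)) ((splitLast d).symm (⊤, b))) := fun a b => by
    rw [Measure.fst_apply measurableSet_Icc, ← Set.prod_univ, ← Set.Icc_bot_top, map_initLast_Icc_prod_Icc]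
  rw [h, h, h, h]
  have key := hμ ((splitLast d).symm (⊥, a)) ((splitLast d).symm (⊤, b)) ((splitLast d).symm (⊥, a'))
    ((splitLast d).symm (⊤, b'))
  rwa [splitLast_symm_inf, splitLast_symm_inf, splitLast_symm_sup, splitLast_symm_sup, bot_inf_eq, top_inf_eq,
    bot_sup_eq, top_sup_eq] at key

/-- The box inequality behind the cut condition: for boxes `[lo,hi] ≤ [lo',hi']` of `Q_d` in the strong set order
and any levels `τ`, `s` of the last coordinate,
`μ([lo,hi] × [s,1]) μ([lo',hi'] × [0,τ]) ≤ μ([lo,hi] × [0,τ]) μ([lo',hi'] × [s,1])`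
(all boxes of `Q_{d+1}`, written through `initLast`). [this work] -/
theorem IsBoxTP2.prod_closed_sides {μ : Measure (Fin (d + 1) → I)} (hμ : IsBoxTP2 μ) {lo hi lo' hi' : Fin d → I}
    (hlo : lo ≤ lo') (hhi : hi ≤ hi') (τ s : I) :
    μ.map initLast (Icc lo hi ×ˢ Icc s ⊤) * μ.map initLast (Icc lo' hi' ×ˢ Icc ⊥ τ) ≤
      μ.map initLast (Icc lo hi ×ˢ Icc ⊥ τ) * μ.map initLast (Icc lo' hi' ×ˢ Icc s ⊤) := by
  rw [map_initLast_Icc_prod_Icc, map_initLast_Icc_prod_Icc, map_initLast_Icc_prod_Icc, map_initLast_Icc_prod_Icc]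
  have key := hμ ((splitLast d).symm (s, lo)) ((splitLast d).symm (⊤, hi)) ((splitLast d).symm (⊥, lo'))
    ((splitLast d).symm (τ, hi'))
  rwa [splitLast_symm_inf, splitLast_symm_inf, splitLast_symm_sup, splitLast_symm_sup, inf_bot_eq,
    inf_eq_left.2 hlo, top_inf_eq, inf_eq_left.2 hhi, sup_bot_eq, sup_eq_right.2 hlo, top_sup_eq,
    sup_eq_right.2 hhi] at key

/-- The law of `((x_0,…,x_{d-1}), x_d)` with the last coordinate read in `ℝ`. -/
def lawInitLastReal (μ : Measure (Fin (d + 1) → I)) : Measure ((Fin d → I) × ℝ) :=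
  (μ.map initLast).map (Prod.map id ((↑) : I → ℝ))

/-- Measurability of `(y, v) ↦ (y, ↑v)`. [folklore] -/
theorem measurable_prodMap_coe {α : Type*} [MeasurableSpace α] :
    Measurable (Prod.map (id : α → α) ((↑) : I → ℝ)) :=
  measurable_id.prodMap measurable_subtype_coe

/-- `(y, v) ↦ (y, ↑v)` is a measurable embedding. [folklore] -/
theorem measurableEmbedding_prodMap_coe {α : Type*} [MeasurableSpace α] :
    MeasurableEmbedding (Prod.map (id : α → α) ((↑) : I → ℝ)) :=
  MeasurableEmbedding.id.prodMap (MeasurableEmbedding.subtype_coe measurableSet_Icc)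

/-- The law of `((x_0,…,x_{d-1}), x_d)` is a probability measure. [folklore] -/
instance instIsProbabilityMeasureMapInitLast [IsProbabilityMeasure μ] : IsProbabilityMeasure (μ.map initLast) :=
  Measure.isProbabilityMeasure_map measurable_initLast.aemeasurable

/-- `lawInitLastReal μ` is a probability measure. [folklore] -/
instance instIsProbabilityMeasureLawInitLastReal [IsProbabilityMeasure μ] :
    IsProbabilityMeasure (lawInitLastReal μ) :=
  Measure.isProbabilityMeasure_map measurable_prodMap_coe.aemeasurable

/-- The first marginal of `lawInitLastReal μ` is the law of the first `d` coordinates. [folklore] -/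
theorem fst_lawInitLastReal : (lawInitLastReal μ).fst = (μ.map initLast).fst := by
  rw [lawInitLastReal, show Prod.map (id : (Fin d → I) → (Fin d → I)) ((↑) : I → ℝ) =
    fun p => (p.1, (p.2 : ℝ)) from rfl,
    Measure.fst_map_prodMk (X := Prod.fst) (Y := fun p : (Fin d → I) × I => (p.2 : ℝ))
      (measurable_subtype_coe.comp measurable_snd)]
  rfl

/-- Rectangle masses of `lawInitLastReal μ`. [folklore] -/
theorem lawInitLastReal_prod {A : Set (Fin d → I)} (hA : MeasurableSet A) {L : Set ℝ} (hL : MeasurableSet L) :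
    lawInitLastReal μ (A ×ˢ L) = μ.map initLast (A ×ˢ (((↑) : I → ℝ) ⁻¹' L)) := by
  rw [lawInitLastReal, Measure.map_apply measurable_prodMap_coe (hA.prod hL), Set.preimage_prod_map_prod,
    Set.preimage_id]

/-- Below `0` the real threshold cuts nothing off `[0,1]`. [folklore] -/
theorem coe_preimage_Iic_of_neg {t : ℝ} (ht : t < 0) : ((↑) : I → ℝ) ⁻¹' Iic t = ∅ :=
  Set.eq_empty_of_forall_notMem fun y hy => lt_irrefl (0 : ℝ) ((y.2.1.trans hy).trans_lt ht)

/-- From `1` on the real threshold leaves nothing of `[0,1]` above it. [folklore] -/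
theorem coe_preimage_Ioi_of_one_le {t : ℝ} (ht : 1 ≤ t) : ((↑) : I → ℝ) ⁻¹' Ioi t = ∅ :=
  Set.eq_empty_of_forall_notMem fun y hy => not_lt.2 (y.2.2.trans ht) hy

/-- For `t ∈ [0,1]`: `{v : ↑v ≤ t} = [0, t]`. [folklore] -/
theorem coe_preimage_Iic_of_mem {t : ℝ} (ht0 : 0 ≤ t) (ht1 : t ≤ 1) :
    ((↑) : I → ℝ) ⁻¹' Iic t = Icc ⊥ ⟨t, ht0, ht1⟩ := by
  ext y
  simp only [mem_preimage, mem_Iic, mem_Icc, bot_le, true_and]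
  exact Iff.rfl

/-- For `t ∈ [0,1]`: `{v : t < ↑v} = (t, 1]`. [folklore] -/
theorem coe_preimage_Ioi_of_mem {t : ℝ} (ht0 : 0 ≤ t) (ht1 : t ≤ 1) :
    ((↑) : I → ℝ) ⁻¹' Ioi t = Ioi ⟨t, ht0, ht1⟩ := by
  ext y
  simp only [mem_preimage, mem_Ioi]
  exact Iff.rfl

/-- `(t, 1]` is the increasing union of the closed sides `[min(t + 1/(n+1), 1), 1]` (`0 ≤ t < 1`). [folklore] -/
theorem iUnion_Icc_eq_Ioi {t : ℝ} (ht0 : 0 ≤ t) (ht1 : t < 1) :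
    (⋃ n : ℕ, Icc (projIcc 0 1 zero_le_one (t + 1 / ((n : ℝ) + 1))) (⊤ : I)) = Ioi ⟨t, ht0, ht1.le⟩ := by
  ext y
  simp only [mem_iUnion, mem_Icc, le_top, and_true, mem_Ioi]
  constructor
  · rintro ⟨n, hn⟩
    have hn' := Subtype.coe_le_coe.2 hn
    rw [coe_projIcc] at hn'
    have hpos : (0 : ℝ) < 1 / ((n : ℝ) + 1) := by positivity
    have hlt : t < max 0 (min 1 (t + 1 / ((n : ℝ) + 1))) := lt_max_of_lt_right (lt_min ht1 (by linarith))
    exact Subtype.coe_lt_coe.1 (hlt.trans_le hn')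
  · intro hty
    have hty' : t < (y : ℝ) := Subtype.coe_lt_coe.2 hty
    obtain ⟨n, hn⟩ := exists_nat_one_div_lt (sub_pos.2 hty')
    refine ⟨n, Subtype.coe_le_coe.1 ?_⟩
    rw [coe_projIcc]
    exact max_le y.2.1 (min_le_of_right_le (by linarith))

/-- The closed sides `[min(t + 1/(n+1), 1), 1]` increase with `n`. [folklore] -/
theorem monotone_Icc_projIcc (t : ℝ) :
    Monotone fun n : ℕ => Icc (projIcc 0 1 zero_le_one (t + 1 / ((n : ℝ) + 1))) (⊤ : I) := by
  intro m n hmn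
  refine Icc_subset_Icc (monotone_projIcc _ ?_) le_rfl
  have hm : (0 : ℝ) < (m : ℝ) + 1 := by positivity
  have hmn' : (m : ℝ) + 1 ≤ (n : ℝ) + 1 := by exact_mod_cast Nat.succ_le_succ hmn
  have := one_div_le_one_div_of_le hm hmn'
  linarith

/-- **Box-TP₂ on `Q_{d+1}` gives TP₂ across the cut (first `d` coordinates | last coordinate) on concentric
sup-balls** (`SahiBoxTP2Kernel.IsBallTP2Cut` for `lawInitLastReal μ`): the two balls are boxes in the strong set
order, the closed sides give the inequality by `IsBoxTP2`, and the open side `(t,1]` is their increasing union.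
[this work] -/
theorem IsBoxTP2.isBallTP2Cut_lawInitLastReal {μ : Measure (Fin (d + 1) → I)} [IsFiniteMeasure μ]
    (hμ : IsBoxTP2 μ) : IsBallTP2Cut (lawInitLastReal μ) := by
  intro x x' hxx' h hh t
  rw [lawInitLastReal_prod μ measurableSet_closedBall measurableSet_Ioi,
    lawInitLastReal_prod μ measurableSet_closedBall measurableSet_Iic,
    lawInitLastReal_prod μ measurableSet_closedBall measurableSet_Iic,
    lawInitLastReal_prod μ measurableSet_closedBall measurableSet_Ioi, closedBall_eq_Icc x hh.le,
    closedBall_eq_Icc x' hh.le]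
  rcases lt_or_ge t 0 with ht0 | ht0
  · rw [coe_preimage_Iic_of_neg ht0, Set.prod_empty, measure_empty, mul_zero]
    exact zero_le
  rcases le_or_gt 1 t with ht1 | ht1
  · rw [coe_preimage_Ioi_of_one_le ht1, Set.prod_empty, measure_empty, zero_mul]
    exact zero_le
  set ν := μ.map initLast with hν
  set τ : I := ⟨t, ht0, ht1.le⟩ with hτ
  set S : ℕ → Set I := fun n => Icc (projIcc 0 1 zero_le_one (t + 1 / ((n : ℝ) + 1))) ⊤ with hS
  have hmono1 : Monotone fun n => Icc (loCorner x h) (hiCorner x h) ×ˢ S n := fun m n hmn =>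
    Set.prod_mono le_rfl (monotone_Icc_projIcc t hmn)
  have hmono2 : Monotone fun n => Icc (loCorner x' h) (hiCorner x' h) ×ˢ S n := fun m n hmn =>
    Set.prod_mono le_rfl (monotone_Icc_projIcc t hmn)
  rw [coe_preimage_Iic_of_mem ht0 ht1.le, coe_preimage_Ioi_of_mem ht0 ht1.le, ← iUnion_Icc_eq_Ioi ht0 ht1,
    Set.prod_iUnion, Set.prod_iUnion, hmono1.measure_iUnion, hmono2.measure_iUnion, ENNReal.iSup_mul]
  refine iSup_le fun n => ?_
  calc ν (Icc (loCorner x h) (hiCorner x h) ×ˢ S n) * ν (Icc (loCorner x' h) (hiCorner x' h) ×ˢ Icc ⊥ τ)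
      ≤ ν (Icc (loCorner x h) (hiCorner x h) ×ˢ Icc ⊥ τ) * ν (Icc (loCorner x' h) (hiCorner x' h) ×ˢ S n) :=
        hμ.prod_closed_sides (loCorner_mono hxx' h) (hiCorner_mono hxx' h) τ _
    _ ≤ ν (Icc (loCorner x h) (hiCorner x h) ×ˢ Icc ⊥ τ) *
          ⨆ n, ν (Icc (loCorner x' h) (hiCorner x' h) ×ˢ S n) :=
        mul_le_mul' le_rfl (le_iSup (fun n => ν (Icc (loCorner x' h) (hiCorner x' h) ×ˢ S n)) n)

end Split

end Summit.CriticalPhenomena.PercolationContinuityZ3.Theorems.SahiBoxTP2
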